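import Summits.CriticalPhenomena.CardyFormulaZ2.Theses.CardyBoundaryCoulombGas
import Literature.Probability.LatticeModels.PercolationRowTransfer
import Literature.Probability.LatticeModels.RowStatePlanar
import Literature.Probability.Percolation.SharpnessDCTProofs
import Mathlib

/-!
# Sketch — crux-ideate stmt-CriticalPhenomena-13878 (StripClusterRates), ideator 1, round 1

First lemmas of the two idea cards of ideator 1.

* §B (card `two-cluster-rate-is-stationary-gap`): the event identity
  `disagreementEvent_eq_twoClusterEvent` (PROVED: wired-vs-free disagreement of the connectivity
  pattern at the far side of the rectangle = the crux's "two distinct spanning clusters" event) and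
  the typed transfer statement `StationaryGapIsTwoClusterRate` (the two-cluster rate γ₂(n) of the
  crux is an eigenvalue of the ⋆-row chain `PercolationRowTransfer` and is the subleading eigenvalue
  of its UNMARKED (⋆ isolated) block — a chain that cannot even express the two-cluster event).
* §A (card `vesica-zero-free-perron-branch`): the critical anisotropic family `aniRowTransfer S p`
  (vertical bonds open with probability `p`, horizontal with `1 - p`, complex `p`), the commutation
  statement `CriticalFamilyCommutes` and the zero-confinement statement
  `VesicaZeroFreeOneCluster` (Perron branch of the 1-marked block has, in the closed vesica
  `|p| ≤ 1, |p-1| ≤ 1`, no zeros off the critical line `Re p = 1/2` and exactly one conjugate pair on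
  it).
-/

noncomputable section

namespace Summit.CriticalPhenomena.CardyFormulaZ2.Cruxes.StripClusterRates.IdeatorOne

open Filter Set Topology MeasureTheory
open scoped Classical BigOperators
open Literature.Probability.Percolation Literature.Probability.LatticeModels

/-! ## §B — two-cluster rate = stationary gap -/

/-- The crux's second event: two open left–right crossings of `[0,m]×[0,n]` lying in distinct open
clusters of the rectangle (verbatim the set in `StripClusterRates`). -/
def twoClusterEvent (m n : ℕ) : Set (BondConfig (Site 2)) :=
  {ω | ∃ x₁ ∈ (leftSide m n : Set (Site 2)), ∃ y₁ ∈ (rightSide m n : Set (Site 2)),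
    ∃ x₂ ∈ (leftSide m n : Set (Site 2)), ∃ y₂ ∈ (rightSide m n : Set (Site 2)),
      ω ∈ openConnIn (rectangle m n : Set (Site 2)) x₁ y₁ ∧
      ω ∈ openConnIn (rectangle m n : Set (Site 2)) x₂ y₂ ∧
      ω ∉ openConnIn (rectangle m n : Set (Site 2)) x₁ x₂}

/-- `y` is joined inside the rectangle to the left side. -/
def joinedToLeft (m n : ℕ) (y : Site 2) : Set (BondConfig (Site 2)) :=
  {ω | ∃ x ∈ (leftSide m n : Set (Site 2)), ω ∈ openConnIn (rectangle m n : Set (Site 2)) x y}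

/-- Wired-versus-free DISAGREEMENT at the right side: two right-side sites that are joined when the
left side is wired (both are joined to the left side) but not joined inside the rectangle with the
left side free. This is the event on which the grand coupling of the row chain started from the
wired and from the free pattern has not coalesced after `m` steps. -/
def disagreementEvent (m n : ℕ) : Set (BondConfig (Site 2)) :=
  {ω | ∃ y₁ ∈ (rightSide m n : Set (Site 2)), ∃ y₂ ∈ (rightSide m n : Set (Site 2)),
      ω ∈ joinedToLeft m n y₁ ∧ ω ∈ joinedToLeft m n y₂ ∧
      ω ∉ openConnIn (rectangle m n : Set (Site 2)) y₁ y₂}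

section lemmas
variable {S : Set (Site 2)} {x y z : Site 2} {ω : BondConfig (Site 2)}

theorem conn_symm (h : ω ∈ openConnIn S x y) : ω ∈ openConnIn S y x :=
  DCT16.mem_openConnIn_of_pathIn (DCT16.pathIn_of_mem_openConnIn h).symm

theorem conn_trans (h₁ : ω ∈ openConnIn S x y) (h₂ : ω ∈ openConnIn S y z) : ω ∈ openConnIn S x z :=
  DCT16.mem_openConnIn_of_pathIn
    ((DCT16.pathIn_of_mem_openConnIn h₁).trans (DCT16.pathIn_of_mem_openConnIn h₂))

end lemmas

/-- **First lemma of card B (proved).** Disagreement of the wired and free boundary conditions at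
distance `m` is exactly the crux's two-distinct-spanning-clusters event. -/
theorem disagreementEvent_eq_twoClusterEvent (m n : ℕ) :
    disagreementEvent m n = twoClusterEvent m n := by
  ext ω
  constructor
  · rintro ⟨y₁, hy₁, y₂, hy₂, ⟨x₁, hx₁, h₁⟩, ⟨x₂, hx₂, h₂⟩, hne⟩
    refine ⟨x₁, hx₁, y₁, hy₁, x₂, hx₂, y₂, hy₂, h₁, h₂, ?_⟩
    intro h12
    exact hne (conn_trans (conn_symm h₁) (conn_trans h12 h₂))
  · rintro ⟨x₁, hx₁, y₁, hy₁, x₂, hx₂, y₂, hy₂, h₁, h₂, hne⟩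
    refine ⟨y₁, hy₁, y₂, hy₂, ⟨x₁, hx₁, h₁⟩, ⟨x₂, hx₂, h₂⟩, ?_⟩
    intro h12
    exact hne (conn_trans h₁ (conn_trans h12 (conn_symm h₂)))

/-- The two-cluster lengthwise rate of width `n` is `γ` (the second `Tendsto` of the crux). -/
def TwoClusterRate (n : ℕ) (γ : ℝ) : Prop :=
  Tendsto (fun m : ℕ ↦ -Real.log ((bondPercolation (zdGraph 2) half).real (twoClusterEvent m n)) /
    (m : ℝ)) atTop (𝓝 γ)

/-- The columns `{0,…,n}` of the strip (the row chain adds rows over these columns; by the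
coordinate swap of `ℤ²` this is the crux's strip of width `n`). -/
def cols (n : ℕ) : Finset ℤ := Finset.Icc (0 : ℤ) n

/-- The UNMARKED PLANAR row patterns: `⋆` is joined to no site (a closed class of the ⋆-chain
on `PlanarRowState`; on it `planarTransfer` is the stationary connectivity chain of the free strip,
≅ the transfer matrix on the vacuum standard module `W⁰`, Catalan-many states). -/
def Unmarked (n : ℕ) : Type := {π : PlanarRowState (cols n) // ∀ x, ¬ π.1.JoinedToStar x}

instance (n : ℕ) : Fintype (Unmarked n) := by unfold Unmarked; infer_instance

/-- The unmarked (stationary) block of the planar row transfer matrix, as a complex matrix. -/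
def unmarkedBlock (n : ℕ) : Matrix (Unmarked n) (Unmarked n) ℂ :=
  ((planarTransfer (cols n)).submatrix Subtype.val Subtype.val).map (algebraMap ℝ ℂ)

/-- **Transfer statement C⁺ of card B** (`two-cluster-rate-is-stationary-gap`; CONFIRMED to machine
precision for n = 1..5 by kit j008136: λ₂nd(unmarked) = e^{−γ₂(n)} = 0.125, 0.19913, 0.27095,
0.33549, 0.39195, and spec(unmarked) ∖ {1} ⊂ spec(2-marked block) entirely): for every width,
`e^{-γ₂(n)}` is an eigenvalue of the ⋆-row chain, and every eigenvalue `≠ 1` of its unmarked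
(stationary) block has modulus `≤ e^{-γ₂(n)}` — the two-cluster rate is the spectral gap
(relaxation rate) of a chain that cannot express the two-cluster event. Mechanism: at loop
weight 1 the vacuum standard module `W⁰` has the Loewy structure `L⁰ → L⁴` with `L⁴` the head of
`W⁴` (MDKP 2017 §3.2), and the Perron vector of `W⁴` is positive hence not in the radical. -/
def StationaryGapIsTwoClusterRate : Prop :=
  ∀ n : ℕ, 1 ≤ n → ∀ γ : ℝ, TwoClusterRate n γ →
    Module.End.HasEigenvalue (Matrix.toLin' (planarTransfer (cols n))) (Real.exp (-γ)) ∧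
    Real.exp (-γ) < 1 ∧
    (∀ μ : ℂ, μ ∈ spectrum ℂ (Matrix.toLin' (unmarkedBlock n)) → μ ≠ 1 → ‖μ‖ ≤ Real.exp (-γ)) ∧
    ((Real.exp (-γ) : ℂ) ∈ spectrum ℂ (Matrix.toLin' (unmarkedBlock n)))

/-! ## §A — critical anisotropic family and vesica zero-freeness -/

/-- **Critical anisotropic row transfer matrix** (complex parameter): one row step with the
vertical bonds open with "probability" `p` and the horizontal bonds with `1 - p` — the self-dual
line `p_v + p_h = 1` of anisotropic bond percolation on `ℤ²`; `p = 1/2` is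
`PercolationRowTransfer`. Entries are polynomials in `p` with nonnegative integer coefficients in
the basis `p^a (1-p)^b`. -/
def aniRowTransfer (S : Finset ℤ) (p : ℂ) : Matrix (RowState S) (RowState S) ℂ :=
  fun π π' ↦ ∑ OH ∈ ((Finset.univ : Finset (Finset S)) ×ˢ (hEdges S).powerset).filter
      (fun OH ↦ rowStep OH.1 OH.2 π = π'),
    p ^ OH.1.card * (1 - p) ^ (S.card - OH.1.card) *
      (1 - p) ^ OH.2.card * p ^ ((hEdges S).card - OH.2.card)

/-- Onsager–Baxter-type commutation along the self-dual line — **NUMERICALLY FALSE** (kit j008136,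
2026-08-16: for n = 1..5, max|[T(0.3), T(0.55)]| ≈ 0.1 ≈ max|T·T| on the unmarked chain, the full
marked chain and the 1-marked block; moreover T(p) and T(1−p) are not isospectral — the free-wall
axis-parallel strip is not self-dual). Kept as the record of a dead end: the axis-parallel brick
matrices do NOT form a commuting family in `p`; the integrable structure is the staggered
(light-cone) family of `PhysicalStripZeroFreeOneCluster` below, or MDKP's homogeneous `D(u)` of the
diagonal strip plus the DKKMO orientation bridge (card A, Dead lines (a2)). -/
def CriticalFamilyCommutes : Prop :=
  ∀ (S : Finset ℤ) (p p' : ℂ),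
    aniRowTransfer S p * aniRowTransfer S p' = aniRowTransfer S p' * aniRowTransfer S p

/-- The marked row patterns (some site joined to `⋆`): the 1-marked block, whose Perron root at
`p = 1/2` is `e^{-γ₁(n)}`. -/
def Marked (n : ℕ) : Type := {π : RowState (cols n) // ∃ x, π.JoinedToStar x}

instance (n : ℕ) : Fintype (Marked n) := by unfold Marked; infer_instance

/-- The 1-marked block of the anisotropic family. -/
def markedBlock (n : ℕ) (p : ℂ) : Matrix (Marked n) (Marked n) ℂ :=
  (aniRowTransfer (cols n) p).submatrix Subtype.val Subtype.val

/-- The closed vesica piscis `|p| ≤ 1, |p - 1| ≤ 1` — image of the closed physical strip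
`0 ≤ Re u ≤ λ` of the spectral parameter; its axis `Re p = 1/2` is the critical/isotropic line. -/
def closedVesica : Set ℂ := {p | ‖p‖ ≤ 1 ∧ ‖p - 1‖ ≤ 1}

/-- **WITHDRAWN p-form** of card A's C⁺ (it presupposes a common eigenvector of the blocks
`markedBlock n p`, `p ∈ ℂ`, which does not exist: `CriticalFamilyCommutes` fails numerically, kit
j008136). Superseded by `PhysicalStripZeroFreeOneCluster`. Original text: one-cluster sector —
there is a positive common eigenvector of the 1-marked blocks whose eigenvalue branch `Λ`
(a polynomial in `p`, `= e^{-γ₁(n)}` at `p = 1/2`) has, inside the closed vesica, zeros only on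
the critical line, and exactly one conjugate pair of them (`t² = 1`, MDKP 2017 §3.7 for `d = 2`).
This is the analyticity input that turns the `D₃` Y-system / dilogarithm evaluation of the `1/n`
term (`n·γ₁(n) → π·Δ_{1,3} = π/3`) into a proof. -/
def VesicaZeroFreeOneCluster : Prop :=
  ∀ n : ℕ, 1 ≤ n →
    ∃ (v : Marked n → ℝ) (Λ : ℂ → ℂ), (∀ π, 0 < v π) ∧
      (∀ p : ℂ, (markedBlock n p).mulVec (fun π ↦ (v π : ℂ)) = fun π ↦ Λ p * v π) ∧
      (∀ p ∈ closedVesica, Λ p = 0 → p.re = 1 / 2) ∧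
      {p ∈ closedVesica | Λ p = 0}.ncard = 2

/-- The closed physical strip `0 ≤ Re v ≤ π/3` of a spectral parameter with crossing parameter
`λ = π/3` (loop weight `2 cos λ = 1`). -/
def physicalStrip : Set ℂ := {v | 0 ≤ v.re ∧ v.re ≤ Real.pi / 3}

/-- **Transfer statement C⁺ of card A, family-agnostic form.** Whether or not the critical
anisotropic row matrices commute among themselves (kit j008136 (A)), the isotropic 1-marked block
sits inside SOME commuting, crossing-symmetric, entire family `t` (Sklyanin's staggered double-row
matrix of the light-cone lattice with free ends is the intended witness; if `CriticalFamilyCommutes`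
holds one may take `t v = markedBlock n (p v)`), nonnegative on the real trace of the physical
strip, whose Perron branch — the eigenvalue on the positive Perron vector of the isotropic block —
has no zeros in the closed physical strip off the central line `Re v = π/6` and exactly one
conjugate pair on it. The isotropic block is presented as `c · t(v₁)⁻¹ t(v₀)` (light-cone
lattice: Vanicat–Zadnik–Prosen 2018 p. 3 for periodic ends; with Sklyanin's `t(0) ∝ 1` the direct
case `t v₀ ∝ block` is included). -/
def PhysicalStripZeroFreeOneCluster : Prop :=
  ∀ n : ℕ, 1 ≤ n →
    ∃ (t : ℂ → Matrix (Marked n) (Marked n) ℂ) (v₀ v₁ : ℂ) (c : ℂ) (v : Marked n → ℝ) (Λ : ℂ → ℂ),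
      c ≠ 0 ∧ t v₁ * markedBlock n (1 / 2 : ℂ) = c • t v₀ ∧ IsUnit (t v₁) ∧
      (∀ w w' : ℂ, t w * t w' = t w' * t w) ∧
      (∀ w : ℂ, t (Real.pi / 3 - w) = t w) ∧
      (∀ π π' : Marked n, Differentiable ℂ fun w ↦ t w π π') ∧
      (∀ w : ℝ, 0 ≤ w → w ≤ Real.pi / 3 → ∀ π π', 0 ≤ (t w π π').re ∧ (t w π π').im = 0) ∧
      (∀ π, 0 < v π) ∧
      (∀ w : ℂ, (t w).mulVec (fun π ↦ (v π : ℂ)) = fun π ↦ Λ w * v π) ∧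
      (∀ w ∈ physicalStrip, Λ w = 0 → w.re = Real.pi / 6) ∧
      {w ∈ physicalStrip | Λ w = 0 ∧ 0 ≤ w.im}.ncard = 1

/-! ## §C — symmetric Y-system positivity (card `scaling-tba-positive-logs`) -/

/-- **First lemma of card C (proved): in the symmetric `D₃` Y-system the convolved quantities are
exact squared moduli on the real axis.** If `a₁(x - iπ/2)·a₁(x + iπ/2) = (1 + a₂ x)²` for real `x`
(MDKP eq. (3.4.finaly), first relation) and `a₁` is real-analytic about the real axis in the sense
`a₁(x - iπ/2) = conj (a₁(x + iπ/2))` (crossing × conjugation symmetry of the fused Perron branch),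
then `(1 + a₂ x)² = |a₁(x + iπ/2)|² ≥ 0`: the logarithm `ln 𝔄²` entering the TBA convolution is the
log of a nonnegative real function — no branch data — and it vanishes exactly where the fused
branch has a zero on the boundary of its physical strip (link to card A's sealing identity). -/
theorem ysystem_sq_eq_normSq (a₁ a₂ : ℂ → ℂ)
    (hY : ∀ x : ℝ, a₁ (x - Complex.I * (Real.pi / 2)) * a₁ (x + Complex.I * (Real.pi / 2)) = (1 + a₂ x) ^ 2)
    (hre : ∀ x : ℝ, a₁ (x - Complex.I * (Real.pi / 2)) = (starRingEnd ℂ) (a₁ (x + Complex.I * (Real.pi / 2)))) :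
    ∀ x : ℝ, (1 + a₂ x) ^ 2 = (Complex.normSq (a₁ (x + Complex.I * (Real.pi / 2))) : ℂ) := by
  intro x
  rw [← hY x, hre x, Complex.normSq_eq_conj_mul_self]

/-- Consequence: `(1 + a₂ x)²` is real and nonnegative on the real axis. -/
theorem ysystem_sq_nonneg (a₁ a₂ : ℂ → ℂ)
    (hY : ∀ x : ℝ, a₁ (x - Complex.I * (Real.pi / 2)) * a₁ (x + Complex.I * (Real.pi / 2)) = (1 + a₂ x) ^ 2)
    (hre : ∀ x : ℝ, a₁ (x - Complex.I * (Real.pi / 2)) = (starRingEnd ℂ) (a₁ (x + Complex.I * (Real.pi / 2)))) :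
    ∀ x : ℝ, ((1 + a₂ x) ^ 2).im = 0 ∧ 0 ≤ ((1 + a₂ x) ^ 2).re := by
  intro x
  rw [ysystem_sq_eq_normSq a₁ a₂ hY hre x]
  exact ⟨Complex.ofReal_im _, by rw [Complex.ofReal_re]; exact Complex.normSq_nonneg _⟩

/-- The TBA kernel `K(x) = 1/(2π cosh x)` of the `D₃` Y-system (MDKP eq. (3.6.K)). -/
def tbaKernel (x : ℝ) : ℝ := 1 / (2 * Real.pi * Real.cosh x)

/-- **Transfer statement C⁺ of card C (scaling TBA well-posedness, d = 2), real form.** The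
scaling `D₃`-TBA of MDKP §3.6 for the 2-defect ground state (t¹ = 0, t² = 1, k¹ = 1, braid values
𝖺¹(∞) = 3, 𝖺²(∞) = 2) has a unique solution: log-moduli `u₁ u₂ : ℝ → ℝ` and one real zero `y`
of 𝖺² with
  `u₁ x = -4 e^{-x} + 2 (K ∗ (fun t ↦ log |1 + σ_y t · e^{u₂ t}|)) x`,
  `u₂ x = log |tanh ((x - y)/2)| + (K ∗ (fun t ↦ log (1 + e^{u₁ t}))) x`,
(σ_y = -1 left of `y`, +1 right of it: 𝖺² ∈ (-1,0) then > 0), the quantisation condition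
`π = 4 e^{-y} + (1/2π)·∫ 2 log|1 + σ_y t e^{u₂ t}| / sinh (t - y) dt` (absolutely convergent: the
numerator vanishes linearly at `t = y`), and limits
`u₁ → log 3`, `u₂ → log 2` at `+∞`. Stated as existence-and-uniqueness of `(u₁, u₂, y)` in the class
of continuous functions with these limits; the dilogarithm evaluation then gives the finite-size
coefficient `Δ = 1/3` (MDKP §3.6–3.7) — the `N → ∞` half of Bethe-free rigour, complementary to
card A's finite-`N` analyticity. -/
def ScalingTBAWellPosedTwo : Prop :=
  ∃! s : (ℝ → ℝ) × (ℝ → ℝ) × ℝ,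
    let u₁ := s.1; let u₂ := s.2.1; let y := s.2.2
    let σ : ℝ → ℝ := fun t ↦ if t < y then -1 else 1
    Continuous u₁ ∧ ContinuousOn u₂ {t | t ≠ y} ∧
    Tendsto u₁ atTop (𝓝 (Real.log 3)) ∧ Tendsto u₂ atTop (𝓝 (Real.log 2)) ∧
    (∀ x : ℝ, u₁ x = -4 * Real.exp (-x) +
        2 * ∫ t, tbaKernel (x - t) * Real.log |1 + σ t * Real.exp (u₂ t)|) ∧
    (∀ x : ℝ, x ≠ y → u₂ x = Real.log |Real.tanh ((x - y) / 2)| +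
        ∫ t, tbaKernel (x - t) * Real.log (1 + Real.exp (u₁ t))) ∧
    Real.pi = 4 * Real.exp (-y) +
      (1 / (2 * Real.pi)) * ∫ t, 2 * Real.log |1 + σ t * Real.exp (u₂ t)| / Real.sinh (t - y)

end Summit.CriticalPhenomena.CardyFormulaZ2.Cruxes.StripClusterRates.IdeatorOne
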